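import Summits.CriticalPhenomena.PercolationContinuityZ3.Theorems.PercNearOneGluingNoHeavyLowerTailKnQuestion8CoefficientwiseParallel
import Summits.CriticalPhenomena.PercolationContinuityZ3.Theorems.PercNearOneGluingNoHeavyLowerTailKnQuestion8CoefficientwiseHarris

/-!
# The blocked part of the two-colouring form of vdBHK's Theorem 1.4 is nonnegative (every finite multigraph)

Support file (`--supports stmt-CriticalPhenomena-4575`, closed), prover `prim-cplus-coupling` (gen 24); companion of `…KnQuestion8CoefficientwiseOneSided.lean`
(same gen), `…KnQuestion8CoefficientwiseParallel.lean` (same gen, `flipOff_flipOff`), `…KnQuestion8CoefficientwiseLeafNA.lean` (gen 22) and prim-lf-2's `…KnQuestion8CoefficientwiseHarris.lean` (`Coefficientwise.fkg_cell`), whose local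
notation and lemmas are reused.  Memo `prim-cplus-coupling/A5-COUPLING-gen24.md` §1.4.  No definitions, no named facts, no sorries; standard axioms.

Setting (as in the companions).  `ends : ι → Sym2 V`, `t : Finset ι` the red edges, `tᶜ` the blue ones, `CL[t, a]` the red cluster of `a`.  The two-colouring
(coefficientwise) form of vdBHK Thm 1.4, `Δ(f,g) := Σ_t 1[x ∉ cl t z] 1[x ∉ cl tᶜ z] f(cl t x)(g(cl tᶜ z) − g(cl t z)) ≥ 0`, is open.  It is the difference
`Δ = HALF − B₂` of the ONE-SIDED sum `HALF(f,g) = Σ_t 1[x ∉ cl t z] f(cl t x)(g(cl tᶜ z) − g(cl t z))` (only the red disconnection; `≥ 0` for `f ≥ 0`, monotone `g`: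
`twoColouring_bhk14_oneSided`) and the BLOCKED sum over the colourings with a blue but no red `x–z` path,
  `B₂(f,g) := Σ_t 1[x ∉ cl t z] 1[x ∈ cl tᶜ z] f(cl t x)(g(cl tᶜ z) − g(cl t z))`.
THIS FILE proves `B₂(f,g) ≥ 0` for every `f ≥ 0` and monotone `g` (`twoColouring_bhk14_blocked_nonneg`), so that the open inequality is exactly the comparison
`B₂ ≤ HALF` of two nonnegative quantities (memo §1.4; in every census `0 ≤ B₂ ≤ HALF`).  Proof: on the cylinder of colourings with a given red cluster `S` of `x`
(the edges meeting `S` frozen), the blue cluster of `z` contains the red cluster of `z` of the colouring flipped off that cylinder (`Φ`, as in Theorem P), the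
indicator `1[x ∈ cl tᶜ z]` is antitone and `g(cl t z)` monotone in the free coordinates, and FKG on the cylinder (`fkg_cell`, twice) with the flip reindexing gives
`Σ_cyl 1[x ∈ cl tᶜ z] (g(cl (Φ t) z) − g(cl t z)) ≥ 0`.
[cite: VandenbergHaggstromKahn2005, Thm. 1.4 (p. 7)]; context [cite: KozmaNitzan2024, Questions 8–9 (§5.5 p. 36)].
-/

noncomputable section

open Finset
open scoped Classical

namespace Summit.CriticalPhenomena.PercolationContinuityZ3.Theorems

namespace CoefficientwiseNA

variable {V : Type*} [Fintype V] [DecidableEq V] {ι : Type*} [Fintype ι] [DecidableEq ι]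

variable (ends : ι → Sym2 V)

/-- The graph of the red edges `t` (as in the companion files; local notation only). -/
local notation "OG[" t "]" => SimpleGraph.fromEdgeSet (Finset.image ends t : Set (Sym2 V))
/-- The red vertex cluster of `a`. -/
local notation "CL[" t ", " a "]" => Finset.filter (fun v => SimpleGraph.Reachable (OG[t]) a v) Finset.univ
/-- The edges meeting a vertex set `S`. -/
local notation "MEETS[" S "]" => Finset.filter (fun e => ∃ v ∈ S, v ∈ ends e) Finset.univ
/-- Keep the colours on `I`, swap them off `I`. -/
local notation "FLIP[" t ", " I "]" => ((t ∩ I) ∪ (Iᶜ \ t))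
/-- Keep the colours on the edges meeting the red cluster of `a`, swap all the others. -/
local notation "PHI[" t ", " a "]" => FLIP[t, MEETS[CL[t, a]]]

omit [Fintype V] [DecidableEq V] in
/-- On the cylinder `t ∩ I = P`, `FLIP[t, I] = P ∪ (Iᶜ \ t)`. [folklore] -/
theorem flipOff_eq_of_inter_eq {t I P : Finset ι} (h : t ∩ I = P) : FLIP[t, I] = P ∪ (Iᶜ \ t) := by
  rw [← h]

/-- After `Φ`, the red cluster of `z` lies inside the old blue cluster of `z`, when `z` is outside the red cluster of `x`. [folklore] -/
theorem cl_Phi_subset_cl_compl {t : Finset ι} {x z : V} (hz : z ∉ CL[t, x]) : CL[PHI[t, x], z] ⊆ CL[tᶜ, z] := by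
  have hz' : z ∉ CL[PHI[t, x], x] := by rwa [cl_Phi]
  have h := cl_subset_cl_compl_Phi ends (t := PHI[t, x]) (x := z) (z := x) hz'
  rwa [Phi_Phi] at h

/-- **FKG on a cylinder, blocked form.**  On the cylinder `C = {t : t ∩ I = P}`, for an antitone weight `E` and a monotone `γ`, with the antitone
`H(t) := γ(P ∪ (Iᶜ \ t))` (`γ` after flipping the free coordinates):  `Σ_C E·γ ≤ Σ_C E·H`.  (Two applications of `fkg_cell` — `E, γ` negatively and `E, H`
positively correlated on the cylinder — and the flip reindexing `Σ_C H = Σ_C γ`.) [folklore] -/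
theorem sum_cyl_antitone_mul_le (I P : Finset ι) (E γ : Finset ι → ℝ) (hE : Antitone E) (hγ : Monotone γ) :
    ∑ t ∈ univ.filter (fun t : Finset ι => t ∩ I = P), E t * γ t
      ≤ ∑ t ∈ univ.filter (fun t : Finset ι => t ∩ I = P), E t * γ (P ∪ (Iᶜ \ t)) := by
  set C := univ.filter (fun t : Finset ι => t ∩ I = P) with hC
  have memC : ∀ t, t ∈ C ↔ t ∩ I = P := fun t => by simp [hC]
  set H : Finset ι → ℝ := fun t => γ (P ∪ (Iᶜ \ t)) with hH
  have hnegE : Monotone (fun t => -E t) := fun s t hst => neg_le_neg (hE hst)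
  have hnegH : Monotone (fun t => -H t) := by
    intro s t hst
    simp only [hH, neg_le_neg_iff]
    exact hγ (union_subset_union (le_refl P) (sdiff_subset_sdiff (le_refl _) hst))
  have h1 := Coefficientwise.fkg_cell I P (fun t => -E t) (fun t => -H t) hnegE hnegH
  have h2 := Coefficientwise.fkg_cell I P (fun t => -E t) γ hnegE hγ
  rw [← hC] at h1 h2
  simp only [Finset.sum_neg_distrib, mul_neg, neg_mul, neg_neg] at h1 h2
  -- Σ_C H = Σ_C γ via the involution t ↦ FLIP[t, I]
  have hmaps : ∀ t ∈ C, FLIP[t, I] ∈ C := fun t ht => (memC _).2 (by rw [flipOff_inter]; exact (memC t).1 ht)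
  have hHG : ∑ t ∈ C, H t = ∑ t ∈ C, γ t := by
    refine Finset.sum_bij' (fun t _ => FLIP[t, I]) (fun t _ => FLIP[t, I]) hmaps hmaps
      (fun t _ => flipOff_flipOff t I) (fun t _ => flipOff_flipOff t I) ?_
    intro t ht
    simp only [hH]
    rw [(memC t).1 ht]
  by_cases hCe : C = ∅
  · simp [hCe]
  have hpos : (0 : ℝ) < (C.card : ℝ) := by exact_mod_cast Finset.card_pos.2 (Finset.nonempty_iff_ne_empty.2 hCe)
  -- |C| Σ E γ ≤ (Σ E)(Σ γ) = (Σ E)(Σ H) ≤ |C| Σ E H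
  have e2 : (C.card : ℝ) * ∑ t ∈ C, E t * γ t ≤ (∑ t ∈ C, E t) * ∑ t ∈ C, γ t := by nlinarith [h2]
  have e1 : (∑ t ∈ C, E t) * (∑ t ∈ C, H t) ≤ (C.card : ℝ) * ∑ t ∈ C, E t * H t := by nlinarith [h1]
  rw [hHG] at e1
  exact le_of_mul_le_mul_left (e2.trans e1) hpos

/-- **The blocked part of the two-colouring form of vdBHK Thm 1.4 is nonnegative (every finite multigraph).**  For `ends : ι → Sym2 V`, vertices `x, z`, a weight
`f ≥ 0` and a monotone `g : Finset V → ℝ`: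
`0 ≤ Σ_t 1[x ∉ cl t z] · 1[x ∈ cl tᶜ z] · f(cl t x) · (g(cl tᶜ z) − g(cl t z))` — among the colourings with a blue but no red `x–z` path, weighted by `f` of the red
cluster of `x`, the blue cluster of `z` dominates the red one.  With `twoColouring_bhk14_oneSided` this exhibits the open two-colouring inequality as `B₂ ≤ HALF`
with `0 ≤ B₂` and `0 ≤ HALF` (memo A5-COUPLING-gen24 §1.4). [cite: VandenbergHaggstromKahn2005, Thm. 1.4 (p. 7)] -/
theorem twoColouring_bhk14_blocked_nonneg (x z : V) (f g : Finset V → ℝ) (hf0 : ∀ S, 0 ≤ f S) (hg : Monotone g) :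
    0 ≤ ∑ t : Finset ι, (if x ∉ CL[t, z] ∧ x ∈ CL[tᶜ, z]
      then f (CL[t, x]) * (g (CL[tᶜ, z]) - g (CL[t, z])) else 0) := by
  -- Step A: replace the blue cluster of `z` by the (smaller) red cluster of `z` after `Φ`
  set Ψ : Finset ι → ℝ := fun t => if x ∉ CL[t, z] ∧ x ∈ CL[tᶜ, z]
      then f (CL[t, x]) * (g (CL[PHI[t, x], z]) - g (CL[t, z])) else 0 with hΨ
  have hdom : ∀ t : Finset ι, Ψ t ≤ (if x ∉ CL[t, z] ∧ x ∈ CL[tᶜ, z]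
      then f (CL[t, x]) * (g (CL[tᶜ, z]) - g (CL[t, z])) else 0) := by
    intro t
    simp only [hΨ]
    by_cases h : x ∉ CL[t, z] ∧ x ∈ CL[tᶜ, z]
    · rw [if_pos h, if_pos h]
      have hz : z ∉ CL[t, x] := (not_mem_cl_comm ends).1 h.1
      exact mul_le_mul_of_nonneg_left (sub_le_sub_right (hg (cl_Phi_subset_cl_compl ends hz)) _) (hf0 _)
    · rw [if_neg h, if_neg h]
  refine le_trans ?_ (Finset.sum_le_sum fun t _ => hdom t)
  -- Step B: group by the cylinder of the red cluster of `x`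
  set key : Finset ι → Finset V × Finset ι := fun t => (CL[t, x], t ∩ MEETS[CL[t, x]]) with hkey
  rw [← Finset.sum_fiberwise_of_maps_to (s := (univ : Finset (Finset ι))) (t := univ.image key) (g := key)
    (fun t _ => mem_image_of_mem key (mem_univ t))]
  refine Finset.sum_nonneg fun k hk => ?_
  obtain ⟨t₀, _, ht₀⟩ := mem_image.1 hk
  obtain ⟨S, P⟩ := k
  have hS : CL[t₀, x] = S := (Prod.mk.inj ht₀).1
  have hP : t₀ ∩ MEETS[S] = P := by have := (Prod.mk.inj ht₀).2; rwa [hS] at this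
  set I := MEETS[S] with hI
  -- the fibre is the cylinder `{t : t ∩ I = P}`
  have hfib : univ.filter (fun t : Finset ι => key t = (S, P)) = univ.filter (fun t : Finset ι => t ∩ I = P) := by
    ext t
    constructor
    · intro ht
      have hk : key t = (S, P) := (Finset.mem_filter.1 ht).2
      have hk1 : CL[t, x] = S := (Prod.mk.inj hk).1
      have hk2 : t ∩ MEETS[CL[t, x]] = P := (Prod.mk.inj hk).2
      rw [hk1] at hk2
      exact Finset.mem_filter.2 ⟨Finset.mem_univ _, hk2⟩
    · intro ht
      have h : t ∩ I = P := (Finset.mem_filter.1 ht).2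
      have hcl : CL[t, x] = CL[t₀, x] := by
        apply cl_eq_of_agree ends
        rw [hS, ← hI, h, hP]
      refine Finset.mem_filter.2 ⟨Finset.mem_univ _, ?_⟩
      show (CL[t, x], t ∩ MEETS[CL[t, x]]) = (S, P)
      rw [hcl, hS, ← hI, h]
  rw [hfib]
  -- on the cylinder, `Ψ t = f(S) · E(t) · (H(t) − γ(t))` with `E` antitone, `γ` monotone
  set E : Finset ι → ℝ := fun t => if x ∈ CL[tᶜ, z] then (1 : ℝ) else 0 with hE
  set γ : Finset ι → ℝ := fun t => g (CL[t, z]) with hγ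
  have hEanti : Antitone E := by
    intro s t hst
    simp only [hE]
    by_cases ht : x ∈ CL[tᶜ, z]
    · have hs : x ∈ CL[sᶜ, z] := cl_mono ends (compl_subset_compl.2 hst) z ht
      rw [if_pos ht, if_pos hs]
    · rw [if_neg ht]
      by_cases hs : x ∈ CL[sᶜ, z]
      · rw [if_pos hs]; norm_num
      · rw [if_neg hs]
  have hγm : Monotone γ := fun s t hst => hg (cl_mono ends hst z)
  have hcl_of : ∀ t ∈ univ.filter (fun t : Finset ι => t ∩ I = P), CL[t, x] = S := by
    intro t ht
    have ht' : t ∩ I = P := by simpa using ht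
    rw [← hS]
    apply cl_eq_of_agree ends
    rw [hS, ← hI, ht', hP]
  by_cases hzS : z ∈ S
  · -- the red cluster of `x` contains `z`: the indicator vanishes on the whole cylinder
    refine le_of_eq (Finset.sum_eq_zero fun t ht => ?_).symm
    have hx : ¬(x ∉ CL[t, z]) := by
      rw [not_mem_cl_comm ends, hcl_of t ht]; exact fun h => h hzS
    have : ¬(x ∉ CL[t, z] ∧ x ∈ CL[tᶜ, z]) := fun h => hx h.1
    simp only [hΨ]
    rw [if_neg this]
  · have hcyl : ∀ t ∈ univ.filter (fun t : Finset ι => t ∩ I = P),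
        Ψ t = f S * (E t * γ (P ∪ (Iᶜ \ t)) - E t * γ t) := by
      intro t ht
      have ht' : t ∩ I = P := by simpa using ht
      have hcl : CL[t, x] = S := hcl_of t ht
      have hPhi : PHI[t, x] = P ∪ (Iᶜ \ t) := by rw [hcl, ← hI]; exact flipOff_eq_of_inter_eq ht'
      have hx : x ∉ CL[t, z] := by rw [not_mem_cl_comm ends, hcl]; exact hzS
      simp only [hΨ, hE, hγ]
      rw [hPhi, hcl]
      by_cases hb : x ∈ CL[tᶜ, z]
      · rw [if_pos ⟨hx, hb⟩, if_pos hb]; ring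
      · have : ¬(x ∉ CL[t, z] ∧ x ∈ CL[tᶜ, z]) := fun h => hb h.2
        rw [if_neg this, if_neg hb]; ring
    rw [Finset.sum_congr rfl hcyl, ← Finset.mul_sum, Finset.sum_sub_distrib]
    exact mul_nonneg (hf0 S) (sub_nonneg.2 (sum_cyl_antitone_mul_le I P E γ hEanti hγm))

end CoefficientwiseNA

end Summit.CriticalPhenomena.PercolationContinuityZ3.Theorems
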